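import Summits.SmoothPoincare4.SmoothPoincare4.Theses.EntropyRung
import Literature.Geometry.Riemannian.PuncturedShrinkingSphereFour
import Literature.Geometry.Lorentzian.WeylConformal
import Literature.Geometry.Lorentzian.ChartWeyl

/-!
# `ChangGurskyYang` minus compactness is false (negative lemma for crux stmt-SmoothPoincare4-10834)

Crux `EntropyRung.ChangGurskyYang` (= the named fact `changGurskyYang_sphere_four`, Chang–Gursky–Yang
2003 Thm. A, simply connected `scal > 0` case): a compact simply connected smooth `4`-manifold with a
`C^∞` Riemannian metric of positive scalar curvature and Weyl energy `∫|W|² dV < 32π²` is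
diffeomorphic to `S⁴`. This file records that CLOSEDNESS IS LOAD-BEARING: with `[CompactSpace M]`
deleted the statement is refuted by the punctured round sphere `S⁴(√6) ∖ {pt} = (ℝ⁴, 96(|y|²+4)⁻² δ)`
(tree: `PuncturedShrinkingSphereFour.punctP` on `W4 = ↥(⊤ : Opens ℝ⁴)`): smooth, Riemannian,
`R ≡ 2 > 0`, `|W|² ≡ 0` (conformal covariance of the Weyl norm, `weylNormSq_conformal_sq`, applied to
`g_p = (e^{w})² δ` and the flat `δ`), `ℝ⁴` simply connected (contractible) and `ℝ⁴ ≇ S⁴` (not compact).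
Refuter negative lemma (cdisprove gen 1); supports the crux item. Everything proved.

## References

* S.-Y. A. Chang, M. J. Gursky, P. C. Yang, Publ. Math. IHÉS 98 (2003) 105–143, Thm. A. [ChangGurskyYang2003]
* A. L. Besse, *Einstein manifolds* (1987), Thm. 1.159 (conformal covariance of `W`). [Besse1987]
* J. M. Lee, *Introduction to Riemannian Manifolds* (2018), Ch. 3 (stereographic coordinates). [Lee2018]
-/

noncomputable section

namespace Summit.SmoothPoincare4.SmoothPoincare4.Theorems.ChangGurskyYang.Negative

set_option linter.dupNamespace false

open scoped Manifold ContDiff Topology RealInnerProductSpace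
open Literature.Geometry.Lorentzian Literature.Geometry.Lorentzian.PseudoRiemannianMetric
open Literature.Geometry.Riemannian
open PuncturedSphereFour RoundCylinderFour

/-- The flat metric `δ` on `ℝ⁴ = ↥⊤` has vanishing curvature tensor (`riemAt` of constant components
is `0`). [folklore] -/
theorem flatW_curvatureForm (x : W4) (a b c d : EuclideanFour) :
    flatW.curvatureForm flatW.leviCivita x a b c d = 0 := by
  rw [OpensChart.curvatureForm_eq_apply_riemAt flatW_val x, MetricCoord.riemAt_constMetric]
  simp

/-- Hence `|W_δ|² ≡ 0` (all of `Rm`, `Ric`, `S` vanish in every frame). [folklore] -/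
theorem flatW_weylNormSq (x : W4) : flatW.weylNormSq x = 0 := by
  refine flatW.weylNormSq_eq_zero x fun e _ i j k l ↦ ?_
  rw [weylFrame_apply]
  simp [flatW_curvatureForm, ricci_flatW, scalarCurvature_flatW]

/-- `δ` is Riemannian. [folklore] -/
theorem isRiemannian_flatW : flatW.IsRiemannian := fun y v hv ↦ by
  rw [flatW_apply]; exact real_inner_self_pos.mpr hv

/-- **`|W|² ≡ 0` for the punctured sphere `g_p = e^{2w} δ`**: `|W_{ψ²δ}|² = ψ⁻⁴|W_δ|² = 0` with
`ψ = e^{w}` (Besse 1987, Thm. 1.159; tree `weylNormSq_conformal_sq`). [cite: Besse1987, Thm. 1.159] -/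
theorem punctP_weylNormSq (x : W4) : punctP.weylNormSq x = 0 := by
  have h3 : 3 ≤ Module.finrank ℝ EuclideanFour := by
    rw [finrank_euclideanSpace_fin]; norm_num
  have hψ : ContMDiff 𝓘(ℝ, EuclideanFour) 𝓘(ℝ) ∞
      (fun y : W4 ↦ Real.exp (wE (y : EuclideanFour))) :=
    (Real.contDiff_exp.comp contDiff_wE).contMDiff.comp contMDiff_subtype_val
  rw [weylNormSq_conformal_sq h3 flatW punctP isRiemannian_flatW hψ (fun y ↦ Real.exp_pos _) ?_ x,
    flatW_weylNormSq, mul_zero]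
  intro y v w
  change Real.exp (2 * wE (y : EuclideanFour)) * innerSL ℝ (E := EuclideanFour) v w =
    Real.exp (wE (y : EuclideanFour)) ^ 2 * innerSL ℝ (E := EuclideanFour) v w
  rw [sq, ← Real.exp_add, ← two_mul]

/-- **The punctured round sphere has zero Weyl energy.** [cite: Besse1987, Thm. 1.159] -/
theorem punctP_weylEnergy : punctP.weylEnergy = 0 :=
  punctP.weylEnergy_eq_zero_of_weylNormSq_eq_zero punctP_weylNormSq

/-- `ℝ⁴ = ↥⊤` is contractible (homeomorphic to the vector space `ℝ⁴`). [folklore] -/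
theorem contractibleSpace_W4 : ContractibleSpace W4 :=
  (⟨⟨Subtype.val, fun y ↦ ⟨y, trivial⟩, fun _ ↦ rfl, fun _ ↦ rfl⟩, continuous_subtype_val,
    continuous_id.subtype_mk _⟩ : W4 ≃ₜ EuclideanFour).contractibleSpace

/-- `ℝ⁴ ≇ S⁴`: a diffeomorphism would make the non-compact `ℝ⁴` compact. [folklore] -/
theorem not_diffeomorph_W4 :
    ¬ Nonempty (W4 ≃ₘ⟮𝓡 4, 𝓡 4⟯ Metric.sphere (0 : EuclideanSpace ℝ (Fin 5)) 1) := by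
  rintro ⟨e⟩
  haveI : CompactSpace W4 := e.toHomeomorph.symm.compactSpace
  exact not_compactSpace_iff.mpr (inferInstance : NoncompactSpace W4) ‹_›

/-- **Compactness is load-bearing for `ChangGurskyYang`**: the crux with `[CompactSpace M]` deleted
is FALSE — `(ℝ⁴, 96(|y|²+4)⁻²δ) = S⁴(√6) ∖ {pt}` is smooth, Riemannian, simply connected, has
`R = 2 > 0` and `∫|W|² dV = 0 < 32π²`, and is not diffeomorphic to `S⁴`. Any proof of the crux must
use closedness (in print: Chern–Gauss–Bonnet and Margerin's flow on a closed manifold).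
[cite: ChangGurskyYang2003, Thm. A] -/
theorem changGurskyYang_false_without_compact :
    ¬ (∀ (M : Type) [TopologicalSpace M] [T2Space M] [SecondCountableTopology M]
        [ChartedSpace (EuclideanSpace ℝ (Fin 4)) M] [IsManifold (𝓡 4) ∞ M] [SimplyConnectedSpace M],
        (∃ g : PseudoRiemannianMetric (𝓡 4) ∞ (EuclideanSpace ℝ (Fin 4)) (TangentSpace (𝓡 4) : M → Type _),
          ∃ _ : g.HasLeviCivita, g.IsRiemannian ∧ (∀ x, 0 < g.scalarCurvature x) ∧
            g.weylEnergy < ENNReal.ofReal (32 * Real.pi ^ 2)) →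
        Nonempty (M ≃ₘ⟮𝓡 4, 𝓡 4⟯ Metric.sphere (0 : EuclideanSpace ℝ (Fin 5)) 1)) := by
  intro h
  haveI : ContractibleSpace W4 := contractibleSpace_W4
  refine not_diffeomorph_W4 (h W4 ⟨punctP, inferInstance, isRiemannian_punctP, fun x ↦ ?_, ?_⟩)
  · rw [scalarCurvature_punctP]; norm_num
  · rw [punctP_weylEnergy]; exact ENNReal.ofReal_pos.2 (by positivity)

end Summit.SmoothPoincare4.SmoothPoincare4.Theorems.ChangGurskyYang.Negative

end
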